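import Mathlib
import HarnessLib
import Literature.Probability.Percolation.IkhlefPonsaingFirstPassageProofs
import Literature.Probability.Percolation.RSW
import Literature.Probability.Percolation.HarrisTheorem
import Literature.Probability.Percolation.TreeGraphBound
import Literature.Probability.LatticeModels.ThermodynamicLimit

/-!
# `stub_boxLimit` of line `Sketch` (crux `EquilateralAntiFactorisation`, stmt-CriticalPhenomena-7800):
# box exhaustion of the triple connection event

Registered stub of the lead's skeleton, proved DEF-FREE. With `Λ_n = box 3 n ⊆ ℤ³` and
`P_p = bondPercolation (zdGraph 3) p`, the claim is
`P_p({x ↔ y in Λ_n} ∩ {x ↔ z in Λ_n}) → P_p({x ↔ y} ∩ {x ↔ z})` as `n → ∞`.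
Proof: `E_n := {x ↔ y in Λ_n} ∩ {x ↔ z in Λ_n}` is non-decreasing in `n` (`openConnIn_mono`,
`box_mono`); the union of an intersection of two non-decreasing families is the intersection of the
unions (`Set.iUnion_inter_of_monotone`); `⋃ₙ {x ↔ y in Λ_n} = {x ↔ y in ⋃ₙ Λ_n} = {x ↔ y in univ}`
(`openConnIn_iUnion_of_monotone`, `iUnion_coe_box`) `= {x ↔ y}` (`openConnIn_subset_openConn`,
`openConnIn_univ_of_reachable`); conclude by continuity of the measure from below
(`tendsto_measure_iUnion_atTop`, no measurability needed) and `ENNReal.tendsto_toReal`.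
-/

noncomputable section

namespace Summit.CriticalPhenomena.PercolationContinuityZ3.Theorems.EquilateralAntiFactorisation

open MeasureTheory Filter Topology
open Literature.Probability.Percolation Literature.Probability.LatticeModels

namespace BoxLimit

variable {V : Type*}

/-- `{x ↔ y in univ} = {x ↔ y}`: an open connection inside the whole vertex set is an open
connection. -/
theorem openConnIn_univ_eq_openConn (x y : V) :
    (openConnIn (Set.univ : Set V) x y : Set (BondConfig V)) = openConn x y :=
  Set.Subset.antisymm (openConnIn_subset_openConn _ x y)
    fun _ hω => openConnIn_univ_of_reachable hω

/-- Along a non-decreasing sequence of vertex sets `Sₙ`, the triple events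
`{x ↔ y in Sₙ} ∩ {x ↔ z in Sₙ}` are non-decreasing. -/
theorem monotone_inter_openConnIn {S : ℕ → Set V} (hS : Monotone S) (x y z : V) :
    Monotone fun n => (openConnIn (S n) x y ∩ openConnIn (S n) x z : Set (BondConfig V)) :=
  fun _ _ hmn => Set.inter_subset_inter (openConnIn_mono (hS hmn) x y)
    (openConnIn_mono (hS hmn) x z)

/-- Along a non-decreasing exhaustion `Sₙ ↑ univ`, the triple events exhaust the unrestricted one:
`⋃ₙ ({x ↔ y in Sₙ} ∩ {x ↔ z in Sₙ}) = {x ↔ y} ∩ {x ↔ z}`. -/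
theorem iUnion_inter_openConnIn_eq {S : ℕ → Set V} (hS : Monotone S)
    (hU : ⋃ n, S n = Set.univ) (x y z : V) :
    ⋃ n, (openConnIn (S n) x y ∩ openConnIn (S n) x z : Set (BondConfig V)) =
      openConn x y ∩ openConn x z := by
  rw [Set.iUnion_inter_of_monotone (monotone_openConnIn hS x y) (monotone_openConnIn hS x z),
    ← openConnIn_iUnion_of_monotone hS x y, ← openConnIn_iUnion_of_monotone hS x z, hU,
    openConnIn_univ_eq_openConn, openConnIn_univ_eq_openConn]

/-- **Continuity from below for the triple event** under a finite measure on bond configurations: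
`μ({x ↔ y in Sₙ} ∩ {x ↔ z in Sₙ}) → μ({x ↔ y} ∩ {x ↔ z})` (real-valued) along a non-decreasing
exhaustion `Sₙ ↑ univ`. -/
theorem tendsto_measureReal_inter_openConnIn (μ : Measure (BondConfig V)) [IsFiniteMeasure μ]
    {S : ℕ → Set V} (hS : Monotone S) (hU : ⋃ n, S n = Set.univ) (x y z : V) :
    Tendsto (fun n => μ.real (openConnIn (S n) x y ∩ openConnIn (S n) x z)) atTop
      (𝓝 (μ.real (openConn x y ∩ openConn x z))) := by
  have h := tendsto_measure_iUnion_atTop (μ := μ) (monotone_inter_openConnIn hS x y z)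
  rw [iUnion_inter_openConnIn_eq hS hU x y z] at h
  simp only [measureReal_def]
  exact (ENNReal.tendsto_toReal (measure_ne_top μ _)).comp h

end BoxLimit

/-- **S5 (box exhaustion).** `P_p({x ↔ y in Λ_n} ∩ {x ↔ z in Λ_n}) → P_p(x ↔ y ∧ x ↔ z)` as
`n → ∞` (continuity from below along the increasing union of the boxes `Λ_n = box 3 n`; with
`z = y` this is `P_p(x ↔ y in Λ_n) ↑ τ_p(x,y)`). -/
theorem stub_boxLimit (p : unitInterval) (x y z : Site 3) :
    Tendsto (fun n : ℕ => (bondPercolation (zdGraph 3) p).real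
      (openConnIn (↑(box 3 n) : Set (Site 3)) x y ∩ openConnIn (↑(box 3 n) : Set (Site 3)) x z))
      atTop (𝓝 ((bondPercolation (zdGraph 3) p).real (openConn x y ∩ openConn x z))) :=
  BoxLimit.tendsto_measureReal_inter_openConnIn (bondPercolation (zdGraph 3) p)
    (S := fun n : ℕ => (↑(box 3 n) : Set (Site 3)))
    (fun _ _ hmn => Finset.coe_subset.2 (box_mono 3 hmn)) (iUnion_coe_box 3) x y z

end Summit.CriticalPhenomena.PercolationContinuityZ3.Theorems.EquilateralAntiFactorisation

end
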